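import Literature.MathematicalPhysics.QuantumFieldTheory.Dimock2015.AnalyticLipschitz
import Summits.QuantumFields.BalabanUV.Beta.EriceRemainderEnclosureHistoryTwoLoop

/-!
# EriceRemainderEnclosureHistoryAnalytic — (E31) THE HISTORY CHANNEL ON THE ANALYTIC ROAD, POSITIVE SIDE: joint analyticity of
# β_{k+1} in ALL its couplings with ONE (ϱ, M) gives a SUP-NORM modulus free of the number of couplings (hence (D4-J2)'s
# off-diagonal oscillation `O(γ)`), and node U2's history WEIGHTS are the COORDINATEWISE COMPLEX AMPLITUDES: `Λ k i = 4·O k i∕ϱ`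

Cell `pub-balaban`, β-function sub-cell, BINDER row D4 «RemainderConst leaves for Bałaban's split» (`HOME/BINDER-OWNERS.md`; owner
lineage `b2b-balaban-beta-an4`; this file by co-owner #2 lineage `b2b-balaban-beta-d4-p2`, generation 33), β-FLOW TEAM duty (1)
under the rulings «YM REDIRECT» (FREEZE (0) honoured: def-free module in the lineage's `EriceRemainderEnclosure*` series, no new leaf)
and «YM ACCELERATION» item (2).  OCCASION.  [Balaban1987RG1] p. 266 tl. 33–37 prints, of the second choice of the characteristic
functions, *«It has the advantage that the functions E^{(j)}, β_j are analytic functions of the effective coupling constants»* —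
PLURAL: all the preceding couplings (p. 298 *«although it depends also on all preceding coupling constants»*).  The row's analytic
road so far reads this in ONE variable (OWNER (D4-J5)∕(D4-J7)∕(D4-J8) `RemainderCouplingHolomorphy*`, this lineage's (E17)–(E22),
(E27)): holomorphy in the LAST coupling, uniform over histories, already pays (AF-1) and binder (D4)'s junction
(`RemainderCouplingHolomorphy.junction_of_holo`).  The HISTORY CHANNEL ((D4-J2) `…HistoryJunction`, (E30) `…HistoryTwoLoop`, road
P3's log-moment) prices the dependence on the OLD couplings in node U2's currency `T4CouplingMatching.HistLipschitz Λ γ β` ∕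
`FadingMemory C θ Λ`.  THIS FILE records what the several-variable reading of p. 266 supplies in that currency, BY NAME from the
tree's Cauchy-estimate module `Dimock2015.AnalyticLipschitz` (node U3 uses the same module for NE9, `T4CouplingAnalyticity`):
(§1) with ONE `(ϱ, M)` uniform in the scale AND in the number of variables, a sup-norm modulus `(4M∕ϱ)·‖p − q‖_∞` — dimension-free,
so (D4-J2)'s off-diagonal oscillation is `≤ (4M∕ϱ)·γ` at every scale — and the UNIFORM coordinatewise clause `Λ ≡ 4M∕ϱ` (total
weight LINEAR in `k`); (§2) the weights ARE the coordinatewise complex AMPLITUDES: if `B k` oscillates by at most `O k i` in the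
`i`-th complex coupling, then `HistLipschitz (4·O∕ϱ) γ₀ β` — so fading memory is GEOMETRIC DECAY OF THE AMPLITUDES (the complexified
irrelevance of the old terms, (0.29) p. 258), and then (E30)'s two-loop law follows by name (§3).  The companions
`…HistoryAnalyticWalsh` ∕ `…HistoryAnalyticSharp` show the amplitudes are a genuinely NEW input: an ENTIRE, uniformly bounded family
with (AF-1) admits NO summable history modulus at all.

HONEST FRAMING (page 1 of everything the β sub-cell writes).  *"Discharging BetaPertH makes Bałaban's UV stability UNCONDITIONAL —
a real constructive-QFT result; it is NOT the continuum limit and NOT the Clay problem."*  THIS FILE DISCHARGES NOTHING OF THE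
KIND.  It is [folklore] complex analysis (the Cauchy bound with a margin, a telescoping over hybrid histories) about an ABSTRACT
history family `β : FlowStep.HBeta`; every holomorphic extension `B k` on `D k ⊆ ℂ^{k+1}`, every bound `M`, radius `ϱ` and amplitude
`O k i` is a HYPOTHESIS, NOT PRINTED with constants for Bałaban's β-functions (p. 266 is qualitative; GAPS G-t4-U2-2); nothing of
[I] (1.22) is asserted, constructed or instantiated; row D4 class UNCHANGED (critical-path width 0; instance 0∕1; D4 DISCHARGE NO
DATE); NOT B12 Thm 2, NOT BetaPertH, NOT continuum, NOT Clay.  HONEST DEPENDENCY: continuum YM on T⁴ ⇐ BetaPertH ∧ nine spine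
estimates (0/9 proved); BetaPertH ⇐ (D1) ∧ (D4) ∧ CAP+tail; G-an2-4 gates asym, D1 and NE2/3/4.  ABSOLUTE RULE: nothing is cited as a
fact; every statement is proved about the typed shapes.

WHAT IS PROVED ([folklore]; 0 sorry; 0 `def`).  §1 `abs_sub_le_of_holoAll` (`|β k p − β k q| ≤ (4M∕ϱ)‖p − q‖_∞` on the box),
`histLipschitz_uniform_of_holoAll` (`HistLipschitz (fun _ _ => 4M∕ϱ) γ₀ β`), `osc_le_of_holoAll` ((D4-J2)'s (OSC): `≤ (4M∕ϱ)γ`).  §2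
`abs_sub_update_le_of_coordOsc` (one coordinate: the slice minus its base value is bounded by the amplitude `O`, margin lemma ⇒
`(4O∕ϱ)|s − u_J|`), **`histLipschitz_of_coordOsc`** (`HistLipschitz (fun k i => 4·O k i∕ϱ) γ₀ β`), `fadingMemory_of_geomAmplitude`
(`O k i ≤ Aθ^{k−i}` ⇒ `FadingMemory (4A∕ϱ) θ`), `orderOneModulus_of_quotient_coordOsc` (β = g_k·G, [I] (2.13): road P3's
(AF-1)-order modulus (M11) with `lam k i = 4·O k i∕ϱ` from the amplitudes of the QUOTIENT `G`).  §3 END **`twoLoopLaw_of_diagTL_of_geomAmplitude`**: (E30)'s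
`twoLoopLaw_of_diagTL_of_fadingMemory` with its pair (`HistLipschitz`, `FadingMemory`) PRODUCED from joint analyticity + geometric
amplitudes — node U2's run-level two-loop law of the bare coupling with the DIAGONAL's coefficient and `C₃ ↦ C₃ + (4A∕ϱ)(θ∕(1−θ)²)β′`;
`geomAmplitude_binders_inhabited` (NON-VACUITY of the analytic data by node U2's Markov two-loop family `b + c·p_k²`, `θ = 0`).
All located inputs NOT-IN-PRINT; `BetaFlowAsPrinted S` records a Markov β_n only ⇒ no junction of the as-printed interface changes.
-/

noncomputable section

open Finset Metric Set

namespace Summit.QuantumFields.BalabanUV.Beta.EriceRemainderEnclosureHistoryAnalytic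

open Literature.MathematicalPhysics.QuantumFieldTheory.Balaban1983to89
open Literature.MathematicalPhysics.QuantumFieldTheory.Balaban1983to89.FlowStep
open Literature.MathematicalPhysics.QuantumFieldTheory.Balaban1983to89.T4CouplingMatching
open Literature.MathematicalPhysics.QuantumFieldTheory.Balaban1983to89.T4TwoLoopLaw (twoLoopConst)
open Literature.MathematicalPhysics.QuantumFieldTheory.Dimock2015
open Summit.QuantumFields.BalabanUV.Beta.EriceRemainderEnclosureHistoryTwoLoop (twoLoopLaw_of_diagTL_of_fadingMemory)

variable {β : HBeta}

/-! ## §1 Joint analyticity with ONE (ϱ, M): the sup-norm modulus, dimension-free -/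

/-- The complexification of real histories is an isometry for the sup norms: `‖p^ℂ − q^ℂ‖ ≤ ‖p − q‖`. [folklore] -/
theorem norm_ofReal_sub_le {k : ℕ} (p q : Fin (k + 1) → ℝ) :
    ‖(fun i => (p i : ℂ)) - (fun i => (q i : ℂ))‖ ≤ ‖p - q‖ := by
  refine (pi_norm_le_iff_of_nonneg (norm_nonneg _)).2 fun i => ?_
  rw [Pi.sub_apply, ← Complex.ofReal_sub, Complex.norm_real]
  exact norm_le_pi_norm (p - q) i

/-- Two histories of a box are sup-norm `γ`-close: `‖p − q‖ ≤ γ` on ]0,γ]^{k+1}. [folklore] -/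
theorem norm_sub_le_of_mem_box {γ : ℝ} {k : ℕ} {p q : Fin (k + 1) → ℝ} (hp : p ∈ Box γ k) (hq : q ∈ Box γ k) :
    ‖p - q‖ ≤ γ := by
  have hγ : 0 ≤ γ := ((mem_box.1 hp 0).1.trans_le (mem_box.1 hp 0).2).le
  refine (pi_norm_le_iff_of_nonneg hγ).2 fun i => ?_
  rw [Pi.sub_apply, Real.norm_eq_abs]
  exact EriceRemainderEnclosureHistoryJunction.abs_sub_le_of_mem_Ioc (mem_box.1 hp i) (mem_box.1 hq i)

/-- **JOINT ANALYTICITY WITH ONE `(ϱ, M)` GIVES A SUP-NORM MODULUS, FREE OF THE NUMBER OF COUPLINGS.**  If at scale `k` the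
history function `β k` is the restriction to ]0,γ₀]^{k+1} of a function `B` complex-differentiable on `D ⊆ ℂ^{k+1}` with `‖B‖ ≤ M`
there, and `D` contains the closed sup-norm `ϱ`-polydisc about every real history of the box, then
`|β k p − β k q| ≤ (4M∕ϱ)·‖p − q‖_∞` on the box (`Dimock2015.AnalyticLipschitz.norm_sub_le_of_margin` BY NAME; the dimension `k + 1`
never enters). [cite: Balaban1987RG1, §2 p.266 tl.33–37 «analytic functions of the effective coupling constants» — shape only] -/
theorem abs_sub_le_of_holoAll {k : ℕ} {D : Set (Fin (k + 1) → ℂ)} {B : (Fin (k + 1) → ℂ) → ℂ} {γ₀ ϱ M : ℝ} (hϱ : 0 < ϱ)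
    (hHol : DifferentiableOn ℂ B D) (hM : ∀ z ∈ D, ‖B z‖ ≤ M)
    (hD : ∀ s : Fin (k + 1) → ℝ, s ∈ Box γ₀ k → closedBall (fun i => (s i : ℂ)) ϱ ⊆ D)
    (hB : ∀ p : Fin (k + 1) → ℝ, p ∈ Box γ₀ k → B (fun i => (p i : ℂ)) = ((β k p : ℝ) : ℂ))
    {p q : Fin (k + 1) → ℝ} (hp : p ∈ Box γ₀ k) (hq : q ∈ Box γ₀ k) :
    |β k p - β k q| ≤ 4 * M / ϱ * ‖p - q‖ := by
  have hS : ∀ y ∈ (fun s : Fin (k + 1) → ℝ => fun i => (s i : ℂ)) '' Box γ₀ k, closedBall y ϱ ⊆ D := by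
    rintro _ ⟨s, hs, rfl⟩; exact hD s hs
  have h := norm_sub_le_of_margin hϱ hHol hM hS (mem_image_of_mem _ hp) (mem_image_of_mem _ hq)
  rw [hB p hp, hB q hq, ← Complex.ofReal_sub, Complex.norm_real, Real.norm_eq_abs] at h
  have hM0 : 0 ≤ M := (norm_nonneg _).trans (hM _ (hD p hp (mem_closedBall_self hϱ.le)))
  exact h.trans (mul_le_mul_of_nonneg_left (norm_ofReal_sub_le p q) (by positivity))

/-- Hence the UNIFORM coordinatewise modulus `HistLipschitz (fun _ _ => 4M∕ϱ) γ₀ β` — total weight `(k + 1)·4M∕ϱ`, LINEAR in the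
number of couplings (the instance `T4CouplingMatching.histLipschitz_of_coordLipschitz` records as having NO fading memory) — from
joint analyticity at every scale with one `(ϱ, M)`. [folklore] -/
theorem histLipschitz_uniform_of_holoAll {D : (k : ℕ) → Set (Fin (k + 1) → ℂ)} {B : (k : ℕ) → (Fin (k + 1) → ℂ) → ℂ}
    {γ₀ ϱ M : ℝ} (hϱ : 0 < ϱ) (hHol : ∀ k, DifferentiableOn ℂ (B k) (D k)) (hM : ∀ k, ∀ z ∈ D k, ‖B k z‖ ≤ M)
    (hD : ∀ (k : ℕ) (s : Fin (k + 1) → ℝ), s ∈ Box γ₀ k → closedBall (fun i => (s i : ℂ)) ϱ ⊆ D k)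
    (hB : ∀ (k : ℕ) (p : Fin (k + 1) → ℝ), p ∈ Box γ₀ k → B k (fun i => (p i : ℂ)) = ((β k p : ℝ) : ℂ)) :
    HistLipschitz (fun _ _ => 4 * M / ϱ) γ₀ β := by
  intro k p q hp hq
  refine (abs_sub_le_of_holoAll hϱ (hHol k) (hM k) (hD k) (hB k) hp hq).trans ?_
  rw [← mul_sum]
  have hM0 : 0 ≤ M := (norm_nonneg _).trans (hM k _ (hD k p hp (mem_closedBall_self hϱ.le)))
  refine mul_le_mul_of_nonneg_left ?_ (by positivity)
  refine (pi_norm_le_iff_of_nonneg (sum_nonneg fun i _ => abs_nonneg _)).2 fun i => ?_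
  rw [Pi.sub_apply, Real.norm_eq_abs]
  exact single_le_sum (f := fun j => |p j - q j|) (fun j _ => abs_nonneg _) (mem_univ i)

/-- **THE OFF-DIAGONAL OSCILLATION IS `O(γ)` UNIFORMLY IN THE SCALE** — (D4-J2)'s (OSC) half of the junction, paid WITHOUT any
summable weight: on ]0,γ]^{k+1}, `γ ≤ γ₀`, `|β k p − β k (p_k,…,p_k)| ≤ (4M∕ϱ)·γ`. [folklore] -/
theorem osc_le_of_holoAll {k : ℕ} {D : Set (Fin (k + 1) → ℂ)} {B : (Fin (k + 1) → ℂ) → ℂ} {γ₀ ϱ M : ℝ} (hϱ : 0 < ϱ)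
    (hHol : DifferentiableOn ℂ B D) (hM : ∀ z ∈ D, ‖B z‖ ≤ M)
    (hD : ∀ s : Fin (k + 1) → ℝ, s ∈ Box γ₀ k → closedBall (fun i => (s i : ℂ)) ϱ ⊆ D)
    (hB : ∀ p : Fin (k + 1) → ℝ, p ∈ Box γ₀ k → B (fun i => (p i : ℂ)) = ((β k p : ℝ) : ℂ))
    {γ : ℝ} (hγ : γ ≤ γ₀) {p : Fin (k + 1) → ℝ} (hp : p ∈ B12Beta.HistBox γ k) :
    |β k p - β k (fun _ : Fin (k + 1) => p (Fin.last k))| ≤ 4 * M / ϱ * γ := by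
  have hpB : p ∈ Box γ k := by rwa [histBox_eq_box] at hp
  have hcB : (fun _ : Fin (k + 1) => p (Fin.last k)) ∈ Box γ k := mem_box.2 fun _ => mem_box.1 hpB _
  have hmono : ∀ {v : Fin (k + 1) → ℝ}, v ∈ Box γ k → v ∈ Box γ₀ k :=
    fun hv => mem_box.2 fun i => ⟨(mem_box.1 hv i).1, (mem_box.1 hv i).2.trans hγ⟩
  have hM0 : 0 ≤ M := (norm_nonneg _).trans (hM _ (hD p (hmono hpB) (mem_closedBall_self hϱ.le)))
  exact (abs_sub_le_of_holoAll hϱ hHol hM hD hB (hmono hpB) (hmono hcB)).trans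
    (mul_le_mul_of_nonneg_left (norm_sub_le_of_mem_box hpB hcB) (by positivity))

/-! ## §2 COORDINATEWISE complex amplitudes are the history weights: `Λ k i = 4·O k i ∕ ϱ` -/

/-- Complexification commutes with updating one coordinate. [folklore] -/
theorem ofReal_update {k : ℕ} (u : Fin (k + 1) → ℝ) (J : Fin (k + 1)) (s : ℝ) :
    (fun i => ((Function.update u J s i : ℝ) : ℂ)) = Function.update (fun i => (u i : ℂ)) J (s : ℂ) := by
  funext i
  by_cases h : i = J
  · subst h; simp
  · simp [Function.update_of_ne h]

/-- **ONE COORDINATE.**  Under joint analyticity as in §1, if moreover the COMPLEX OSCILLATION of `B` in the coordinate `J` is at most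
`O` on `D` (`‖B z − B w‖ ≤ O` whenever `z, w ∈ D` differ only at `J`), then changing the `J`-th coupling of a real history of the box
from `u J` to `s ∈ ]0,γ₀]` moves `β k` by at most `(4O∕ϱ)·|s − u J|` — the one-variable margin lemma applied to the slice MINUS its
value at the base point (a function bounded by the oscillation, not by `M`). [folklore] -/
theorem abs_sub_update_le_of_coordOsc {k : ℕ} {D : Set (Fin (k + 1) → ℂ)} {B : (Fin (k + 1) → ℂ) → ℂ} {γ₀ ϱ O : ℝ}
    (hϱ : 0 < ϱ) (hHol : DifferentiableOn ℂ B D)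
    (hD : ∀ s : Fin (k + 1) → ℝ, s ∈ Box γ₀ k → closedBall (fun i => (s i : ℂ)) ϱ ⊆ D)
    (hB : ∀ p : Fin (k + 1) → ℝ, p ∈ Box γ₀ k → B (fun i => (p i : ℂ)) = ((β k p : ℝ) : ℂ))
    {J : Fin (k + 1)} (hO : ∀ z w, z ∈ D → w ∈ D → (∀ j, j ≠ J → z j = w j) → ‖B z - B w‖ ≤ O)
    {u : Fin (k + 1) → ℝ} (hu : u ∈ Box γ₀ k) {s : ℝ} (hs : 0 < s ∧ s ≤ γ₀) :
    |β k (Function.update u J s) - β k u| ≤ 4 * O / ϱ * |s - u J| := by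
  set uC : Fin (k + 1) → ℂ := fun i => (u i : ℂ) with huC
  set D' : Set ℂ := {t | Function.update uC J t ∈ D} with hD'
  set g : ℂ → ℂ := fun t => B (Function.update uC J t) - B uC with hg
  have huD : uC ∈ D := hD u hu (mem_closedBall_self hϱ.le)
  -- hybrid real histories stay in the box
  have hupd : ∀ r : ℝ, 0 < r ∧ r ≤ γ₀ → Function.update u J r ∈ Box γ₀ k := by
    intro r hr
    refine mem_box.2 fun i => ?_
    rw [Function.update_apply]
    split_ifs
    · exact hr
    · exact mem_box.1 hu i
  -- the slice domain contains the closed ϱ-discs about the admissible real values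
  have hdisc : ∀ r ∈ Icc (min s (u J)) γ₀, closedBall (r : ℂ) ϱ ⊆ D' := by
    intro r hr t ht
    have hr' : 0 < r ∧ r ≤ γ₀ := ⟨(lt_min hs.1 (mem_box.1 hu J).1).trans_le hr.1, hr.2⟩
    have hsub := hD _ (hupd r hr')
    show Function.update uC J t ∈ D
    refine hsub ?_
    rw [ofReal_update, mem_closedBall, dist_eq_norm]
    refine (pi_norm_le_iff_of_nonneg hϱ.le).2 fun i => ?_
    rw [Pi.sub_apply]
    by_cases h : i = J
    · subst h
      simpa [Function.update_self, ← dist_eq_norm] using (mem_closedBall.1 ht)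
    · simp [huC, Function.update_of_ne h, hϱ.le]
  have hgdiff : DifferentiableOn ℂ g D' := by
    refine DifferentiableOn.sub ?_ (differentiableOn_const _)
    exact hHol.comp (fun t _ => (hasDerivAt_update uC J t).differentiableAt.differentiableWithinAt) fun t ht => ht
  have hgO : ∀ t ∈ D', ‖g t‖ ≤ O := by
    intro t ht
    refine hO _ _ ht huD fun j hj => ?_
    rw [Function.update_of_ne hj]
  have hsI : s ∈ Icc (min s (u J)) γ₀ := ⟨min_le_left _ _, hs.2⟩
  have huI : u J ∈ Icc (min s (u J)) γ₀ := ⟨min_le_right _ _, (mem_box.1 hu J).2⟩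
  have h := real_param_lipschitz hϱ hgdiff hgO hdisc hsI huI
  have hg_s : g (s : ℂ) = ((β k (Function.update u J s) : ℝ) : ℂ) - ((β k u : ℝ) : ℂ) := by
    rw [hg]
    show B (Function.update uC J (s : ℂ)) - B uC = _
    rw [← ofReal_update, hB _ (hupd s hs), hB u hu]
  have hg_u : g ((u J : ℝ) : ℂ) = 0 := by
    rw [hg]
    show B (Function.update uC J ((u J : ℝ) : ℂ)) - B uC = 0
    rw [show ((u J : ℝ) : ℂ) = uC J from rfl, Function.update_eq_self, sub_self]
  rw [hg_s, hg_u, sub_zero, ← Complex.ofReal_sub, Complex.norm_real, Real.norm_eq_abs] at h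
  exact h

/-- **THE WEIGHTS ARE THE COMPLEX AMPLITUDES.**  If at every scale `β k` extends to `B k`, complex-differentiable on `D k` (closed
sup-norm `ϱ`-polydiscs about the box inside), real on the box, with COORDINATEWISE complex oscillations `O k i` (`‖B k z − B k w‖ ≤
O k i` for `z, w ∈ D k` differing only at coordinate `i`), then `HistLipschitz (fun k i => 4·O k i∕ϱ) γ₀ β` — by telescoping through
the hybrid histories `(q_0,…,q_{j−1},p_j,…,p_k)` (all in the box) and `abs_sub_update_le_of_coordOsc` at each step.  So node U2's
weight of the coupling of age `a` IS (`4∕ϱ` times) the complex amplitude of the dependence on it; fading memory = geometric decay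
of these amplitudes (the complexified irrelevance of the old terms, [Balaban1987RG1] (0.29) p. 258) — an input analyticity itself
does not contain (companion `…HistoryAnalyticSharp`). [cite: Balaban1987RG1, §2 p.266 tl.33–37 and (0.29) p.258 — shapes only] -/
theorem histLipschitz_of_coordOsc {D : (k : ℕ) → Set (Fin (k + 1) → ℂ)} {B : (k : ℕ) → (Fin (k + 1) → ℂ) → ℂ}
    {O : ℕ → ℕ → ℝ} {γ₀ ϱ : ℝ} (hϱ : 0 < ϱ) (hHol : ∀ k, DifferentiableOn ℂ (B k) (D k))
    (hD : ∀ (k : ℕ) (s : Fin (k + 1) → ℝ), s ∈ Box γ₀ k → closedBall (fun i => (s i : ℂ)) ϱ ⊆ D k)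
    (hB : ∀ (k : ℕ) (p : Fin (k + 1) → ℝ), p ∈ Box γ₀ k → B k (fun i => (p i : ℂ)) = ((β k p : ℝ) : ℂ))
    (hO : ∀ (k : ℕ) (J : Fin (k + 1)) (z w : Fin (k + 1) → ℂ), z ∈ D k → w ∈ D k → (∀ j, j ≠ J → z j = w j) →
      ‖B k z - B k w‖ ≤ O k J) :
    HistLipschitz (fun k i => 4 * O k i / ϱ) γ₀ β := by
  intro k p q hp hq
  -- hybrid histories h j = (q_0,…,q_{j−1},p_j,…,p_k)
  set h : ℕ → (Fin (k + 1) → ℝ) := fun j i => if (i : ℕ) < j then q i else p i with hh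
  have hmem : ∀ j, h j ∈ Box γ₀ k := fun j => mem_box.2 fun i => by
    rw [hh]; dsimp only; split_ifs
    · exact mem_box.1 hq i
    · exact mem_box.1 hp i
  have h0 : h 0 = p := by funext i; simp [hh]
  have hK : h (k + 1) = q := by funext i; simp [hh, i.isLt]
  have hstep : ∀ J : Fin (k + 1), h ((J : ℕ) + 1) = Function.update (h J) J (q J) := by
    intro J; funext i
    rw [hh, Function.update_apply]; dsimp only
    by_cases hiJ : i = J
    · subst hiJ; simp
    · have hne : (i : ℕ) ≠ J := fun e => hiJ (Fin.ext e)
      by_cases hlt : (i : ℕ) < J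
      · rw [if_pos (by omega), if_neg hiJ, if_pos hlt]
      · rw [if_neg (by omega), if_neg hiJ, if_neg hlt]
  set d : ℕ → ℝ := fun j => if hj : j < k + 1 then 4 * O k j / ϱ * |p ⟨j, hj⟩ - q ⟨j, hj⟩| else 0 with hdd
  have hd : ∀ j, j < k + 1 → dist (β k (h j)) (β k (h (j + 1))) ≤ d j := by
    intro j hj
    rw [hdd]; dsimp only; rw [dif_pos hj]
    set J : Fin (k + 1) := ⟨j, hj⟩
    have hJ : (J : ℕ) = j := rfl
    rw [dist_comm, Real.dist_eq, ← hJ, hstep J]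
    have := abs_sub_update_le_of_coordOsc hϱ (hHol k) (hD k) (hB k) (hO k J) (hmem J) (mem_box.1 hq J)
    have hJval : h (J : ℕ) J = p J := by rw [hh]; simp
    rw [hJval, abs_sub_comm (q J)] at this
    exact this
  have htel := dist_le_range_sum_of_dist_le (f := fun j => β k (h j)) (k + 1) (fun {j} hj => hd j hj)
  rw [h0, hK, Real.dist_eq, Finset.sum_range] at htel
  refine htel.trans (le_of_eq (sum_congr rfl fun i _ => ?_))
  rw [hdd]; dsimp only; rw [dif_pos i.isLt]

/-- **GEOMETRIC AMPLITUDES ⇒ FADING MEMORY.**  `0 ≤ O k i ≤ A·θ^{k−i}` (`i ≤ k`) ⇒ `FadingMemory (4A∕ϱ) θ (fun k i => 4·O k i∕ϱ)`.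
[folklore] -/
theorem fadingMemory_of_geomAmplitude {O : ℕ → ℕ → ℝ} {A θ ϱ : ℝ} (hϱ : 0 < ϱ)
    (hO : ∀ k i, i ≤ k → 0 ≤ O k i ∧ O k i ≤ A * θ ^ (k - i)) :
    FadingMemory (4 * A / ϱ) θ (fun k i => 4 * O k i / ϱ) := by
  intro k i hik
  obtain ⟨h0, h1⟩ := hO k i hik
  refine ⟨by positivity, ?_⟩
  rw [div_mul_eq_mul_div, mul_assoc]
  exact div_le_div_of_nonneg_right (mul_le_mul_of_nonneg_left h1 (by norm_num)) hϱ.le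

/-- **ROAD P3's (AF-1)-ORDER MODULUS (M11) FROM AMPLITUDES OF THE QUOTIENT.**  If on the box `β k p = p_k · G k(p^ℂ)` with `G k`
complex-differentiable on `D k` (closed sup-norm `ϱ`-polydiscs about the box inside) and coordinatewise complex amplitudes `O k i` for
`G k` — the shape of [Balaban1987RG1] (2.13) «the expression under the exponential above vanishes at g_k = 0», complexified — then for
histories with the SAME last coupling `|β k p − β k q| ≤ p_k · Σ_i (4·O k i∕ϱ)·|p_i − q_i|`: road P3's (M11) hypothesis shape
(`RemainderExplicitHistoryLogMoment`, `hmem`) with `lam k i = 4·O k i∕ϱ` (`histLipschitz_of_coordOsc` applied to the real family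
`p ↦ β k p ∕ p_k`). [cite: Balaban1987RG1, (2.13) p.268 and §2 p.266 tl.33–37 — shapes only] -/
theorem orderOneModulus_of_quotient_coordOsc {D : (k : ℕ) → Set (Fin (k + 1) → ℂ)} {G : (k : ℕ) → (Fin (k + 1) → ℂ) → ℂ}
    {O : ℕ → ℕ → ℝ} {γ₀ ϱ : ℝ} (hϱ : 0 < ϱ) (hHol : ∀ k, DifferentiableOn ℂ (G k) (D k))
    (hD : ∀ (k : ℕ) (s : Fin (k + 1) → ℝ), s ∈ Box γ₀ k → closedBall (fun i => (s i : ℂ)) ϱ ⊆ D k)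
    (hG : ∀ (k : ℕ) (p : Fin (k + 1) → ℝ), p ∈ Box γ₀ k → ((p (Fin.last k) : ℝ) : ℂ) * G k (fun i => (p i : ℂ)) = ((β k p : ℝ) : ℂ))
    (hO : ∀ (k : ℕ) (J : Fin (k + 1)) (z w : Fin (k + 1) → ℂ), z ∈ D k → w ∈ D k → (∀ j, j ≠ J → z j = w j) →
      ‖G k z - G k w‖ ≤ O k J)
    (k : ℕ) {p q : Fin (k + 1) → ℝ} (hp : p ∈ Box γ₀ k) (hq : q ∈ Box γ₀ k) (hlast : p (Fin.last k) = q (Fin.last k)) :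
    |β k p - β k q| ≤ p (Fin.last k) * ∑ i : Fin (k + 1), 4 * O k i / ϱ * |p i - q i| := by
  -- the real quotient family β' k p = β k p ∕ p_k agrees with G on the box
  have hB : ∀ (k : ℕ) (p : Fin (k + 1) → ℝ), p ∈ Box γ₀ k →
      G k (fun i => (p i : ℂ)) = (((fun k p => β k p / p (Fin.last k)) k p : ℝ) : ℂ) := by
    intro k p hp
    have hpk : (p (Fin.last k) : ℝ) ≠ 0 := (mem_box.1 hp _).1.ne'
    have hpkC : ((p (Fin.last k) : ℝ) : ℂ) ≠ 0 := by exact_mod_cast hpk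
    have h := hG k p hp
    push_cast
    rw [eq_div_iff hpkC, mul_comm]
    exact h
  have hL := histLipschitz_of_coordOsc (β := fun k p => β k p / p (Fin.last k)) hϱ hHol hD hB hO k p q hp hq
  have hpk : 0 < p (Fin.last k) := (mem_box.1 hp _).1
  have e : β k p - β k q = p (Fin.last k) * (β k p / p (Fin.last k) - β k q / q (Fin.last k)) := by
    rw [← hlast]; field_simp
  rw [e, abs_mul, abs_of_pos hpk]
  exact mul_le_mul_of_nonneg_left hL hpk.le

/-! ## §3 END: (E30)'s two-loop law with its history pair PRODUCED from joint analyticity and geometric amplitudes -/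

/-- **END — THE TWO-LOOP LAW OF THE BARE COUPLING FROM JOINT ANALYTICITY WITH GEOMETRICALLY DECAYING AMPLITUDES.**  (E30)'s
`twoLoopLaw_of_diagTL_of_fadingMemory` VERBATIM, except that its located history pair (`HistLipschitz Λ γ β`, `FadingMemory C θ Λ`)
is REPLACED by: a complex-differentiable extension `B k` of `β k` on `D k ⊇` the closed sup-norm `ϱ`-polydiscs about ]0,γ]^{k+1}, real
on the box, whose oscillation in the `i`-th complex coupling is at most `O k i ≤ A·θ^{k−i}` (`0 ≤ θ < 1`).  Conclusion: node U2's
run-level law `|1∕g₀² − 1∕g_K² − Σ_{k<K} β⁰_k − (β¹¹_∞∕β⁰_∞)·log K| ≤ twoLoopConst …` with `C₃ ↦ C₃ + (4A∕ϱ)·(θ∕(1−θ)²)·β′` — the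
DIAGONAL's coefficient, shape AND value.  Every input NOT-IN-PRINT for Bałaban's β (p. 266 qualitative; (0.29) is printed for the
TERMS V^{(j)}(X, U_k)
of (0.28), which sum to −β_j A^η + E^{(j)}; not transcribed into amplitudes of β). [cite: Balaban1987RG1, §2 p.266 tl.33–37, (0.29) p.258, (0.20) p.256, Thm 2
p.259 — shapes only] -/
theorem twoLoopLaw_of_diagTL_of_geomAmplitude (S : B12Beta.OneLoopSplit β)
    {γ b C₁ binf c₀ θ₀ b1inf C₃ c₁ θ₁ β' A θ ϱ : ℝ} {k₀ K : ℕ} {gs : ℕ → ℝ}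
    {D : (k : ℕ) → Set (Fin (k + 1) → ℂ)} {B : (k : ℕ) → (Fin (k + 1) → ℂ) → ℂ} {O : ℕ → ℕ → ℝ}
    (h : RGEqH K β gs) (hbox : ∀ k, k ≤ K → 0 < gs k ∧ gs k ≤ γ) (hb : 0 < b)
    (hlo : EventualLowerH b γ k₀ β) (hC₁ : 0 ≤ C₁)
    (hAF1 : ∀ k (p : Fin (k + 1) → ℝ), p ∈ Box γ k → |S.β1 k p| ≤ C₁ * p (Fin.last k))
    (hθ0 : 0 ≤ θ₀) (hθ1 : θ₀ < 1) (hconv : ∀ k, |S.β0 k - binf| ≤ c₀ * θ₀ ^ k)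
    (hC₃ : 0 ≤ C₃) (hc₁ : 0 ≤ c₁) (hθ₁0 : 0 ≤ θ₁) (hθ₁1 : θ₁ < 1)
    (hsign : ∀ k, k < K → 0 ≤ β k (prefixOf gs k)) (hup : ∀ k, k < K → β k (prefixOf gs k) ≤ β')
    (hdiag : ∀ (k : ℕ) (c : ℝ), 0 < c → c ≤ γ →
      |S.β1 k (fun _ : Fin (k + 1) => c) - b1inf * c ^ 2| ≤ C₃ * c ^ 3 + c₁ * θ₁ ^ k)
    (hϱ : 0 < ϱ) (hHol : ∀ k, DifferentiableOn ℂ (B k) (D k))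
    (hD : ∀ (k : ℕ) (s : Fin (k + 1) → ℝ), s ∈ Box γ k → closedBall (fun i => (s i : ℂ)) ϱ ⊆ D k)
    (hB : ∀ (k : ℕ) (p : Fin (k + 1) → ℝ), p ∈ Box γ k → B k (fun i => (p i : ℂ)) = ((β k p : ℝ) : ℂ))
    (hO : ∀ (k : ℕ) (J : Fin (k + 1)) (z w : Fin (k + 1) → ℂ), z ∈ D k → w ∈ D k → (∀ j, j ≠ J → z j = w j) →
      ‖B k z - B k w‖ ≤ O k J)
    (hOA : ∀ k i, i ≤ k → 0 ≤ O k i ∧ O k i ≤ A * θ ^ (k - i)) (hθf0 : 0 ≤ θ) (hθf1 : θ < 1) (hK : k₀ < K) :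
    |1 / (gs 0) ^ 2 - 1 / (gs K) ^ 2 - ∑ k ∈ range K, S.β0 k - b1inf / binf * Real.log K| ≤
      twoLoopConst b binf γ C₁ c₀ θ₀ b1inf (C₃ + 4 * A / ϱ * (θ / (1 - θ) ^ 2) * β') c₁ θ₁ k₀ (1 / (gs K) ^ 2) :=
  twoLoopLaw_of_diagTL_of_fadingMemory S h hbox hb hlo hC₁ hAF1 hθ0 hθ1 hconv hC₃ hc₁ hθ₁0 hθ₁1 hsign hup hdiag
    (histLipschitz_of_coordOsc hϱ hHol hD hB hO) (fadingMemory_of_geomAmplitude hϱ hOA) hθf0 hθf1 hK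

/-- **NON-VACUITY OF §2–§3's ANALYTIC BINDERS** by node U2's Markov two-loop family `β k p = b + c·p_k²` ((E30b) `e30_binders_inhabited`
inhabits the remaining binders of the END for the same family): with `D k` the closed polydisc `‖z_i‖ ≤ γ + ϱ` and `B k z = b + c·z_k²`,
the data (`hHol`, `hD`, `hB`, `hO`, `hOA`) of `twoLoopLaw_of_diagTL_of_geomAmplitude` hold with amplitudes `O k i = [i = k]·4|c|(γ + ϱ)²`,
`A = 4|c|(γ + ϱ)²`, `θ = 0`. [folklore] -/
theorem geomAmplitude_binders_inhabited (b c : ℝ) {γ ϱ : ℝ} (hγ : 0 < γ) (hϱ : 0 < ϱ) :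
    let βm : HBeta := fun k p => b + c * p (Fin.last k) ^ 2
    let D : (k : ℕ) → Set (Fin (k + 1) → ℂ) := fun _ => {z | ∀ i, ‖z i‖ ≤ γ + ϱ}
    let B : (k : ℕ) → (Fin (k + 1) → ℂ) → ℂ := fun k z => (b : ℂ) + (c : ℂ) * z (Fin.last k) ^ 2
    let O : ℕ → ℕ → ℝ := fun k i => if i = k then 4 * |c| * (γ + ϱ) ^ 2 else 0
    (∀ k, DifferentiableOn ℂ (B k) (D k)) ∧
      (∀ (k : ℕ) (s : Fin (k + 1) → ℝ), s ∈ Box γ k → closedBall (fun i => (s i : ℂ)) ϱ ⊆ D k) ∧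
      (∀ (k : ℕ) (p : Fin (k + 1) → ℝ), p ∈ Box γ k → B k (fun i => (p i : ℂ)) = ((βm k p : ℝ) : ℂ)) ∧
      (∀ (k : ℕ) (J : Fin (k + 1)) (z w : Fin (k + 1) → ℂ), z ∈ D k → w ∈ D k → (∀ j, j ≠ J → z j = w j) →
        ‖B k z - B k w‖ ≤ O k J) ∧
      (∀ k i, i ≤ k → 0 ≤ O k i ∧ O k i ≤ 4 * |c| * (γ + ϱ) ^ 2 * (0 : ℝ) ^ (k - i)) := by
  intro βm D B O
  refine ⟨fun k => ?_, fun k s hs z hz i => ?_, fun k p hp => ?_, fun k J z w hz hw hzw => ?_, fun k i hik => ?_⟩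
  · show DifferentiableOn ℂ (fun z : Fin (k + 1) → ℂ => (b : ℂ) + (c : ℂ) * z (Fin.last k) ^ 2) (D k)
    fun_prop
  · have hsi := mem_box.1 hs i
    have h1 : ‖z i - (s i : ℂ)‖ ≤ ϱ := by
      have := mem_closedBall.1 hz; rw [dist_eq_norm] at this
      exact (norm_le_pi_norm (z - fun j => (s j : ℂ)) i).trans this
    calc ‖z i‖ = ‖(z i - (s i : ℂ)) + (s i : ℂ)‖ := by rw [sub_add_cancel]
      _ ≤ ‖z i - (s i : ℂ)‖ + ‖((s i : ℝ) : ℂ)‖ := norm_add_le _ _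
      _ ≤ ϱ + γ := add_le_add h1 (by rw [Complex.norm_real, Real.norm_eq_abs, abs_of_pos hsi.1]; exact hsi.2)
      _ = γ + ϱ := add_comm _ _
  · show (b : ℂ) + (c : ℂ) * ((p (Fin.last k) : ℝ) : ℂ) ^ 2 = (((b + c * p (Fin.last k) ^ 2 : ℝ)) : ℂ)
    push_cast; ring
  · show ‖((b : ℂ) + (c : ℂ) * z (Fin.last k) ^ 2) - ((b : ℂ) + (c : ℂ) * w (Fin.last k) ^ 2)‖ ≤ O k J
    by_cases hJ : J = Fin.last k
    · have hO : O k J = 4 * |c| * (γ + ϱ) ^ 2 := by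
        show (if (J : ℕ) = k then 4 * |c| * (γ + ϱ) ^ 2 else 0) = _
        rw [if_pos (by rw [hJ, Fin.val_last])]
      rw [hO]
      have hzk := hz (Fin.last k); have hwk := hw (Fin.last k)
      have hR : 0 ≤ γ + ϱ := by linarith
      calc ‖((b : ℂ) + (c : ℂ) * z (Fin.last k) ^ 2) - ((b : ℂ) + (c : ℂ) * w (Fin.last k) ^ 2)‖
          = ‖(c : ℂ)‖ * (‖z (Fin.last k) - w (Fin.last k)‖ * ‖z (Fin.last k) + w (Fin.last k)‖) := by
            rw [show ((b : ℂ) + (c : ℂ) * z (Fin.last k) ^ 2) - ((b : ℂ) + (c : ℂ) * w (Fin.last k) ^ 2) =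
              (c : ℂ) * ((z (Fin.last k) - w (Fin.last k)) * (z (Fin.last k) + w (Fin.last k))) by ring, norm_mul, norm_mul]
        _ ≤ |c| * ((‖z (Fin.last k)‖ + ‖w (Fin.last k)‖) * (‖z (Fin.last k)‖ + ‖w (Fin.last k)‖)) := by
            rw [Complex.norm_real, Real.norm_eq_abs]
            exact mul_le_mul_of_nonneg_left (mul_le_mul (norm_sub_le _ _) (norm_add_le _ _) (norm_nonneg _)
              (by positivity)) (abs_nonneg c)
        _ ≤ |c| * ((γ + ϱ + (γ + ϱ)) * (γ + ϱ + (γ + ϱ))) := by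
            gcongr
        _ = 4 * |c| * (γ + ϱ) ^ 2 := by ring
    · have e : z (Fin.last k) = w (Fin.last k) := hzw _ (Ne.symm hJ)
      rw [e, sub_self, norm_zero]
      show (0 : ℝ) ≤ if (J : ℕ) = k then 4 * |c| * (γ + ϱ) ^ 2 else 0
      split_ifs <;> positivity
  · have hO : O k i = if i = k then 4 * |c| * (γ + ϱ) ^ 2 else 0 := rfl
    rw [hO]
    by_cases h : i = k
    · rw [if_pos h, h, Nat.sub_self, pow_zero, mul_one]; exact ⟨by positivity, le_rfl⟩
    · rw [if_neg h]; exact ⟨le_rfl, by positivity⟩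

end Summit.QuantumFields.BalabanUV.Beta.EriceRemainderEnclosureHistoryAnalytic

end
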